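import Summits.HodgeConjecture.HodgeConjecture.Theorems.SixfoldTableXCensusProductRowsUnitary
import Literature.AlgebraicGeometry.HodgeTheory.TimesTotallyRealFieldStablyNondegenerateProductSpan
import Literature.AlgebraicGeometry.HodgeTheory.TimesTypeIIStablyNondegenerateProductSpan
import Literature.AlgebraicGeometry.HodgeTheory.TimesGluedBlocksProductSpan
import Literature.AlgebraicGeometry.HodgeTheory.TimesLowGenericProductSpan
import Literature.AlgebraicGeometry.HodgeTheory.CentreTimesCMCurveNoEmbedding
import Literature.AlgebraicGeometry.HodgeTheory.ThetaTraceTimesCMProductSpan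
import HarnessLib

/-!
# TABLE X (dimension 6) — MORE KÜNNETH ROWS ON AXIS A7: the product-span theorems of the tree that no cell module had
# consumed (A7 inventory `HOME/jobs/A7-inventory-eng4g4/INVENTORY.md` row 28), each as «A ∼ Y × S ⟹ X2-at-A ∧ X1-at-A»
# in the kernel, unconditionally (cell `pub-hodgeav-hg6`, req-37 (A) Q2b; eng-4 g4, L9d; lead g2 2026-08-28T21:20:02Z)

HONEST FRAMING. HC, `HC_AV` (stmt-1333), `HC_CM` (stmt-3052) and the rung H2 are NOT proved and do not occur here. The
census nodes X2 / X1 (`TableX.SixfoldCodimTwoCensus` / `TableX.SixfoldCodimThreeCensus`) are OURS (`@[conjecture]`), never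
asserted. KERNEL ONLY: theorems over existing declarations; no definition, no `sorry`, no named fact; typed ≠ proved.

MECHANISM (L9, `SixfoldTableXCensusProductRows` §1): `HodgeClassesProductSpan Y S` («the Hodge ring of `Y × S` is generated by
the classes coming from the two factors», Moonen–Zarhin 1999 (3.1)) with `0 < dim Y`, `0 < dim S` gives BOTH census
conclusions at every `A ∼ Y × S` (`census_of_isIsogenous_prod_of_productSpan`: generators by bidegree ↦ pull-back / divisor
/ cup-product summands; L7b isogeny transport). L9 / L9b / L9c consumed six product-span producers of the Literature lane
(Lombardo no-type-IV × CM, × non-CM curve, × generic (D) factor, unitary (dim−1,1) × CM curve, quadratic End × CM curve /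
× simple CM surface). THIS FILE consumes the remaining UNCONDITIONAL producers with sixfold members (all «`Hom(Y, S) = 0`»-type
side conditions are the printed ones):
* §1 `census_of_isIsogenous_prod_realFieldStablyNondegenerate` — `S` stably nondegenerate with `End⁰(S)` a totally real FIELD,
  `Hom(Y, S) = 0` (MZ99 (3.1) with Thm. (3.2) / Lemma (3.4), real multiplication; `TimesTotallyRealFieldStablyNondegenerateProductSpan`);
* §2 `census_of_isIsogenous_prod_typeIIStablyNondegenerate` — `S` SIMPLE of Albert type II, stably nondegenerate, `Hom(Y, S) = 0`
  (`TimesTypeIIStablyNondegenerateProductSpan`);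
* §3 `census_of_isIsogenous_prod_isMurtyTypeWith_one` — `S` of Murty type `m = 1`, `Hom(Y, S) = 0` (MZ99 Lemma (3.4); the concrete
  instance of the abstract glued-blocks producer `hodgeClassesProductSpan_of_gluedBlocks`, `TimesGluedBlocksProductSpan`);
  `census_of_isIsogenous_prod_isSimple_quaternion_of_dim_eq` — `S` simple with QUATERNIONIC multiplication of minimal dimension
  `dim S = 2[K:ℚ]` (the other concrete glued-blocks instance, `hodgeClassesProductSpan_of_avSlots_of_isSimple_quaternion_of_dim_eq`);
* §4 `census_of_isIsogenous_prod_lowGeneric` — `S` with `End⁰(S) = ℚ`, `dim S ≤ 3`, `Hom(Y, S) = 0` (`TimesLowGenericProductSpan`);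
* §5 `census_of_isIsogenous_isSimple_prod_cmCurve` — THE RICHEST: `Y` SIMPLE (any positive dimension) × a CM elliptic curve `E`
  (`χ ≫ χ = −d′`) such that NO central `z ∈ End⁰(Y)` has `z² = −d′` («`k = ℚ(√−d′)` does not embed in the centre», MZ99
  Prop. (3.8); `CentreTimesCMCurveNoEmbedding` — the concrete form of the abstract non-resonance producer
  `hodgeClassesProductSpan_of_centre_cmCurve`); and AT DIMENSION 6 WITH DOMAIN MEMBERSHIP:
  **`sixfoldCensus_of_isIsogenous_simpleFivefold_prod_cmCurve`** — `Y` simple NON-CM fivefold, `E` CM curve, no central square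
  root of `−d′` ⟹ every `A ∼ Y × E`: `(dim A = 6 ∧ ¬ 𝒞 A)` ∧ X2-at-`A` ∧ X1-at-`A` (domain by L9c
  `not_residueClass_of_isIsogenous_prod_of_isSimple_of_not_isOfCMType`: dim `Y = 5 ≠ 4`, a curve is simple). This covers EVERY
  «simple fivefold × CM curve» member of TABLE X rows 16 / 28 whose curve field misses the centre — all four Albert types of
  `Y`, any signature — where L9c reached only `dim_ℚ End⁰(Y) = 2`;
* §6 `census_of_isIsogenous_prod_thetaTrace_cm` — `Y` with the `Θ`-trace condition («`Hg(Y)` semisimple» in Lie form,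
  `HodgeThetaTraceCondition Y`: e.g. no type-IV factor, or BALANCED Weil type `hodgeThetaTraceCondition_of_balanced`) × `C` of CM
  type (`ThetaTraceTimesCMProductSpan`; MZ98 §1 Remark) — e.g. a Weil-type (2,2) fourfold times a CM surface: the fourfold's
  Weil classes arrive at the sixfold as PULL-BACKS (dim 4 < 6), inside X2's pull-back summand by design.
All any-dimension statements are conclusions-only (the powers / other dimensions leave the sixfold domain); §5 carries the
domain clause at dimension 6. No inhabitant is exhibited. Nothing here is a corollary of `HC_CM`; no hypothesis of the cover
is discharged GLOBALLY; X2 / X1 stay `@[conjecture]`; typed ≠ proved.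
-/

set_option linter.dupNamespace false

noncomputable section

open CategoryTheory NumberField
open Literature.AlgebraicGeometry Literature.AlgebraicGeometry.Motives
open Literature.AlgebraicGeometry.Motives.AbelianVariety (IsIsogenous IsSimple)
open Literature.AlgebraicGeometry.HodgeTheory
open Literature.AlgebraicGeometry.ComplexMultiplication (EndField)
open Literature.AlgebraicGeometry.Milne1999
open Literature.AlgebraicTopology.SingularHomology
open Literature.Barriers.HodgeConjecture
open Literature.RingTheory.CentralSimple (IsTotallyIndefinite)
open Literature.NumberTheory.Automorphic (IsQuaternionAlgebra)
open Summit.HodgeConjecture.HodgeConjecture.Ring2.ClassTargets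
open Summit.HodgeConjecture.HodgeConjecture.Ring2.Motiv (ProdCMCell)
open Summit.HodgeConjecture.HodgeConjecture.Ring2.Atlas (IsQuarticFieldTypeIVFourfold)

namespace Summit.HodgeConjecture.HodgeConjecture.TableX.ProductRows

/-! ## §1 `S` stably nondegenerate with real multiplication by a totally real FIELD -/

/-- **`Y × S`, `S` stably nondegenerate with `End⁰(S)` a totally real field, `Hom(Y, S) = 0`**: both census conclusions at
every `A ∼ Y × S` (tree theorem `hodgeClassesProductSpan_of_realFieldStablyNondegenerate_of_forall_hom_eq_zero`, MZ99 (3.1) with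
Thm. (3.2); L9 mechanism). UNCONDITIONAL; any dimensions. [cite: MoonenZarhin1999LowDim, §3 (3.1), Thm. (3.2) and Lemma (3.4)]
[cite: vanGeemen1994HodgeAV, Lemma 3.7] -/
theorem census_of_isIsogenous_prod_realFieldStablyNondegenerate {A Y S : AbelianVariety ℂ} (h0Y : 0 < Y.dim)
    (h0S : 0 < S.dim) (hS : IsStablyNondegenerate S) (hF : IsField S.endAlgebra) [IsTotallyReal (EndField S hF)]
    (hYS : ∀ u : Y ⟶ S, u = 0) (hA : IsIsogenous A (Y.prod S)) :
    (∀ c : complexBetti A.X (2 * 2), IsRationalClass c → IsOfHodgeType A.dim A.X (2 * 2) 2 2 c →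
      c ∈ divisorClassesSpan A.X A.dim 2 ⊔ Submodule.span ℂ {w' : complexBetti A.X (2 * 2) |
        ∃ (C : AbelianVariety ℂ) (g : A.X ⟶ C.X) (w : complexBetti C.X (2 * 2)), C.dim < A.dim ∧
          IsRationalClass w ∧ IsOfHodgeType C.dim C.X (2 * 2) 2 2 w ∧ w' = complexBetti.map g (2 * 2) w}) ∧
    (∀ c : complexBetti A.X (2 * 3), IsRationalClass c → IsOfHodgeType A.dim A.X (2 * 3) 3 3 c →
      c ∈ divisorClassesSpan A.X A.dim 3 ⊔ Submodule.span ℂ {w' : complexBetti A.X (2 * 3) |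
          ∃ (a : complexBetti A.X (2 * 2)) (b : complexBetti A.X (2 * 1)),
            IsRationalClass a ∧ IsOfHodgeType A.dim A.X (2 * 2) 2 2 a ∧ IsRationalClass b ∧
            IsOfHodgeType A.dim A.X (2 * 1) 1 1 b ∧ w' = cupProduct (two_mul_add_two_mul 2 1) a b} ⊔
        Submodule.span ℂ {w' : complexBetti A.X (2 * 3) |
          ∃ (C : AbelianVariety ℂ) (g : A.X ⟶ C.X) (w : complexBetti C.X (2 * 3)), C.dim < A.dim ∧
            IsRationalClass w ∧ IsOfHodgeType C.dim C.X (2 * 3) 3 3 w ∧ w' = complexBetti.map g (2 * 3) w} ⊔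
        Submodule.span ℂ {w' : complexBetti A.X (2 * 3) |
          ∃ (B' : AbelianVariety ℂ) (g : A.X ⟶ B'.X) (d : ℕ) (ψ : B' ⟶ B') (w : complexBetti B'.X (2 * 3)),
            B'.dim = 6 ∧ 0 < d ∧ ψ ≫ ψ = -(d • 𝟙 B') ∧ IsRationalClass w ∧
            IsOfHodgeType B'.dim B'.X (2 * 3) 3 3 w ∧ w ∈ weilClassesOf B' ψ 3 d ∧
            w' = complexBetti.map g (2 * 3) w}) :=
  census_of_isIsogenous_prod_of_productSpan h0Y h0S
    (hodgeClassesProductSpan_of_realFieldStablyNondegenerate_of_forall_hom_eq_zero hS hF hYS) hA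

/-! ## §2 `S` simple of Albert type II, stably nondegenerate -/

/-- **`Y × S`, `S` SIMPLE with `End⁰(S)` a totally indefinite quaternion algebra over a totally real `K`, stably nondegenerate,
`Hom(Y, S) = 0`**: both census conclusions at every `A ∼ Y × S`
(`hodgeClassesProductSpan_of_typeIIStablyNondegenerate_of_forall_hom_eq_zero`). UNCONDITIONAL; any dimensions.
[cite: MoonenZarhin1999LowDim, §3 (3.1) and Thm. (3.2)] [cite: BanaszakGajdaKrason2006, Thm. 7.34] -/
theorem census_of_isIsogenous_prod_typeIIStablyNondegenerate {A Y S : AbelianVariety ℂ} {K : Type} [Field K]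
    [NumberField K] [IsTotallyReal K] [Algebra K S.endAlgebra] [IsScalarTower ℚ K S.endAlgebra]
    [IsQuaternionAlgebra K S.endAlgebra] (h0Y : 0 < Y.dim) (h0S : 0 < S.dim) (hS : IsStablyNondegenerate S)
    (hSs : S.IsSimple) (hind : IsTotallyIndefinite K S.endAlgebra) (hYS : ∀ u : Y ⟶ S, u = 0)
    (hA : IsIsogenous A (Y.prod S)) :
    (∀ c : complexBetti A.X (2 * 2), IsRationalClass c → IsOfHodgeType A.dim A.X (2 * 2) 2 2 c →
      c ∈ divisorClassesSpan A.X A.dim 2 ⊔ Submodule.span ℂ {w' : complexBetti A.X (2 * 2) |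
        ∃ (C : AbelianVariety ℂ) (g : A.X ⟶ C.X) (w : complexBetti C.X (2 * 2)), C.dim < A.dim ∧
          IsRationalClass w ∧ IsOfHodgeType C.dim C.X (2 * 2) 2 2 w ∧ w' = complexBetti.map g (2 * 2) w}) ∧
    (∀ c : complexBetti A.X (2 * 3), IsRationalClass c → IsOfHodgeType A.dim A.X (2 * 3) 3 3 c →
      c ∈ divisorClassesSpan A.X A.dim 3 ⊔ Submodule.span ℂ {w' : complexBetti A.X (2 * 3) |
          ∃ (a : complexBetti A.X (2 * 2)) (b : complexBetti A.X (2 * 1)),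
            IsRationalClass a ∧ IsOfHodgeType A.dim A.X (2 * 2) 2 2 a ∧ IsRationalClass b ∧
            IsOfHodgeType A.dim A.X (2 * 1) 1 1 b ∧ w' = cupProduct (two_mul_add_two_mul 2 1) a b} ⊔
        Submodule.span ℂ {w' : complexBetti A.X (2 * 3) |
          ∃ (C : AbelianVariety ℂ) (g : A.X ⟶ C.X) (w : complexBetti C.X (2 * 3)), C.dim < A.dim ∧
            IsRationalClass w ∧ IsOfHodgeType C.dim C.X (2 * 3) 3 3 w ∧ w' = complexBetti.map g (2 * 3) w} ⊔
        Submodule.span ℂ {w' : complexBetti A.X (2 * 3) |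
          ∃ (B' : AbelianVariety ℂ) (g : A.X ⟶ B'.X) (d : ℕ) (ψ : B' ⟶ B') (w : complexBetti B'.X (2 * 3)),
            B'.dim = 6 ∧ 0 < d ∧ ψ ≫ ψ = -(d • 𝟙 B') ∧ IsRationalClass w ∧
            IsOfHodgeType B'.dim B'.X (2 * 3) 3 3 w ∧ w ∈ weilClassesOf B' ψ 3 d ∧
            w' = complexBetti.map g (2 * 3) w}) :=
  census_of_isIsogenous_prod_of_productSpan h0Y h0S
    (hodgeClassesProductSpan_of_typeIIStablyNondegenerate_of_forall_hom_eq_zero hS hSs hind hYS) hA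

/-! ## §3 Glued blocks: `S` of Murty type `m = 1`, or simple with quaternionic multiplication of minimal dimension -/

/-- **`Y × S`, `S` of Murty type `(K, φ, 1)` (a self-commutant totally real subfield of degree `dim S`), `Hom(Y, S) = 0`**:
both census conclusions at every `A ∼ Y × S` (`hodgeClassesProductSpan_of_isMurtyTypeWith_one_of_forall_hom_eq_zero`, MZ99 Lemma
(3.4) — the glued-blocks producer in concrete form). UNCONDITIONAL; any dimensions. [cite: MoonenZarhin1999LowDim, §2 (2.2), §3 (3.1) and Lemma (3.4)]
[cite: Murty1988, Thm. 2 (p. 67)] -/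
theorem census_of_isIsogenous_prod_isMurtyTypeWith_one {A Y S : AbelianVariety ℂ} {K : Type} [Field K] [NumberField K]
    {φ : K →+* S.endAlgebra} (h0Y : 0 < Y.dim) (h0S : 0 < S.dim) (hSm : IsMurtyTypeWith S K φ 1)
    (hYS : ∀ u : Y ⟶ S, u = 0) (hA : IsIsogenous A (Y.prod S)) :
    (∀ c : complexBetti A.X (2 * 2), IsRationalClass c → IsOfHodgeType A.dim A.X (2 * 2) 2 2 c →
      c ∈ divisorClassesSpan A.X A.dim 2 ⊔ Submodule.span ℂ {w' : complexBetti A.X (2 * 2) |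
        ∃ (C : AbelianVariety ℂ) (g : A.X ⟶ C.X) (w : complexBetti C.X (2 * 2)), C.dim < A.dim ∧
          IsRationalClass w ∧ IsOfHodgeType C.dim C.X (2 * 2) 2 2 w ∧ w' = complexBetti.map g (2 * 2) w}) ∧
    (∀ c : complexBetti A.X (2 * 3), IsRationalClass c → IsOfHodgeType A.dim A.X (2 * 3) 3 3 c →
      c ∈ divisorClassesSpan A.X A.dim 3 ⊔ Submodule.span ℂ {w' : complexBetti A.X (2 * 3) |
          ∃ (a : complexBetti A.X (2 * 2)) (b : complexBetti A.X (2 * 1)),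
            IsRationalClass a ∧ IsOfHodgeType A.dim A.X (2 * 2) 2 2 a ∧ IsRationalClass b ∧
            IsOfHodgeType A.dim A.X (2 * 1) 1 1 b ∧ w' = cupProduct (two_mul_add_two_mul 2 1) a b} ⊔
        Submodule.span ℂ {w' : complexBetti A.X (2 * 3) |
          ∃ (C : AbelianVariety ℂ) (g : A.X ⟶ C.X) (w : complexBetti C.X (2 * 3)), C.dim < A.dim ∧
            IsRationalClass w ∧ IsOfHodgeType C.dim C.X (2 * 3) 3 3 w ∧ w' = complexBetti.map g (2 * 3) w} ⊔
        Submodule.span ℂ {w' : complexBetti A.X (2 * 3) |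
          ∃ (B' : AbelianVariety ℂ) (g : A.X ⟶ B'.X) (d : ℕ) (ψ : B' ⟶ B') (w : complexBetti B'.X (2 * 3)),
            B'.dim = 6 ∧ 0 < d ∧ ψ ≫ ψ = -(d • 𝟙 B') ∧ IsRationalClass w ∧
            IsOfHodgeType B'.dim B'.X (2 * 3) 3 3 w ∧ w ∈ weilClassesOf B' ψ 3 d ∧
            w' = complexBetti.map g (2 * 3) w}) :=
  census_of_isIsogenous_prod_of_productSpan h0Y h0S
    (hodgeClassesProductSpan_of_isMurtyTypeWith_one_of_forall_hom_eq_zero hSm hYS) hA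

/-- **`Y × S`, `S` SIMPLE with `End⁰(S)` a quaternion algebra over a totally real `K` and `dim S = 2[K:ℚ]`, `Hom(Y, S) = 0`**:
both census conclusions at every `A ∼ Y × S` (`hodgeClassesProductSpan_of_avSlots_of_isSimple_quaternion_of_dim_eq` with one slot
on each side; type II forced). UNCONDITIONAL; any dimensions. [cite: MoonenZarhin1999LowDim, §3 (3.1) and Lemma (3.4)]
[cite: BanaszakGajdaKrason2006, Thm. 7.34] -/
theorem census_of_isIsogenous_prod_isSimple_quaternion_of_dim_eq {A Y S : AbelianVariety ℂ} {K : Type} [Field K]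
    [NumberField K] [IsTotallyReal K] [Algebra K S.endAlgebra] [IsScalarTower ℚ K S.endAlgebra]
    [IsQuaternionAlgebra K S.endAlgebra] (h0Y : 0 < Y.dim) (hSs : S.IsSimple)
    (hdim : S.dim = 2 * Module.finrank ℚ K) (hYS : ∀ u : Y ⟶ S, u = 0) (hA : IsIsogenous A (Y.prod S)) :
    (∀ c : complexBetti A.X (2 * 2), IsRationalClass c → IsOfHodgeType A.dim A.X (2 * 2) 2 2 c →
      c ∈ divisorClassesSpan A.X A.dim 2 ⊔ Submodule.span ℂ {w' : complexBetti A.X (2 * 2) |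
        ∃ (C : AbelianVariety ℂ) (g : A.X ⟶ C.X) (w : complexBetti C.X (2 * 2)), C.dim < A.dim ∧
          IsRationalClass w ∧ IsOfHodgeType C.dim C.X (2 * 2) 2 2 w ∧ w' = complexBetti.map g (2 * 2) w}) ∧
    (∀ c : complexBetti A.X (2 * 3), IsRationalClass c → IsOfHodgeType A.dim A.X (2 * 3) 3 3 c →
      c ∈ divisorClassesSpan A.X A.dim 3 ⊔ Submodule.span ℂ {w' : complexBetti A.X (2 * 3) |
          ∃ (a : complexBetti A.X (2 * 2)) (b : complexBetti A.X (2 * 1)),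
            IsRationalClass a ∧ IsOfHodgeType A.dim A.X (2 * 2) 2 2 a ∧ IsRationalClass b ∧
            IsOfHodgeType A.dim A.X (2 * 1) 1 1 b ∧ w' = cupProduct (two_mul_add_two_mul 2 1) a b} ⊔
        Submodule.span ℂ {w' : complexBetti A.X (2 * 3) |
          ∃ (C : AbelianVariety ℂ) (g : A.X ⟶ C.X) (w : complexBetti C.X (2 * 3)), C.dim < A.dim ∧
            IsRationalClass w ∧ IsOfHodgeType C.dim C.X (2 * 3) 3 3 w ∧ w' = complexBetti.map g (2 * 3) w} ⊔
        Submodule.span ℂ {w' : complexBetti A.X (2 * 3) |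
          ∃ (B' : AbelianVariety ℂ) (g : A.X ⟶ B'.X) (d : ℕ) (ψ : B' ⟶ B') (w : complexBetti B'.X (2 * 3)),
            B'.dim = 6 ∧ 0 < d ∧ ψ ≫ ψ = -(d • 𝟙 B') ∧ IsRationalClass w ∧
            IsOfHodgeType B'.dim B'.X (2 * 3) 3 3 w ∧ w ∈ weilClassesOf B' ψ 3 d ∧
            w' = complexBetti.map g (2 * 3) w}) := by
  have h0S : 0 < S.dim := by
    have := Module.finrank_pos (R := ℚ) (M := K); omega
  exact census_of_isIsogenous_prod_of_productSpan h0Y h0S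
    (hodgeClassesProductSpan_of_avSlots_of_isSimple_quaternion_of_dim_eq hSs hdim
      (forall_isHodgeMorphismOne_eq_zero_of_forall_hom_eq_zero hYS) (avSlots_self Y) (avSlots_self S)) hA

/-! ## §4 `S` generic of dimension `≤ 3` -/

/-- **`Y × S`, `End⁰(S) = ℚ`, `0 < dim S ≤ 3`, `Hom(Y, S) = 0`**: both census conclusions at every `A ∼ Y × S`
(`hodgeClassesProductSpan_of_lowGeneric_of_forall_hom_eq_zero`). UNCONDITIONAL; any `dim Y`.
[cite: MoonenZarhin1999LowDim, §2 (2.1), §3 (3.1) and Thm. (3.2)] -/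
theorem census_of_isIsogenous_prod_lowGeneric {A Y S : AbelianVariety ℂ} (h0Y : 0 < Y.dim) (h0S : 0 < S.dim)
    (hS3 : S.dim ≤ 3) (hSend : Module.finrank ℚ S.endAlgebra = 1) (hYS : ∀ u : Y ⟶ S, u = 0)
    (hA : IsIsogenous A (Y.prod S)) :
    (∀ c : complexBetti A.X (2 * 2), IsRationalClass c → IsOfHodgeType A.dim A.X (2 * 2) 2 2 c →
      c ∈ divisorClassesSpan A.X A.dim 2 ⊔ Submodule.span ℂ {w' : complexBetti A.X (2 * 2) |
        ∃ (C : AbelianVariety ℂ) (g : A.X ⟶ C.X) (w : complexBetti C.X (2 * 2)), C.dim < A.dim ∧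
          IsRationalClass w ∧ IsOfHodgeType C.dim C.X (2 * 2) 2 2 w ∧ w' = complexBetti.map g (2 * 2) w}) ∧
    (∀ c : complexBetti A.X (2 * 3), IsRationalClass c → IsOfHodgeType A.dim A.X (2 * 3) 3 3 c →
      c ∈ divisorClassesSpan A.X A.dim 3 ⊔ Submodule.span ℂ {w' : complexBetti A.X (2 * 3) |
          ∃ (a : complexBetti A.X (2 * 2)) (b : complexBetti A.X (2 * 1)),
            IsRationalClass a ∧ IsOfHodgeType A.dim A.X (2 * 2) 2 2 a ∧ IsRationalClass b ∧
            IsOfHodgeType A.dim A.X (2 * 1) 1 1 b ∧ w' = cupProduct (two_mul_add_two_mul 2 1) a b} ⊔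
        Submodule.span ℂ {w' : complexBetti A.X (2 * 3) |
          ∃ (C : AbelianVariety ℂ) (g : A.X ⟶ C.X) (w : complexBetti C.X (2 * 3)), C.dim < A.dim ∧
            IsRationalClass w ∧ IsOfHodgeType C.dim C.X (2 * 3) 3 3 w ∧ w' = complexBetti.map g (2 * 3) w} ⊔
        Submodule.span ℂ {w' : complexBetti A.X (2 * 3) |
          ∃ (B' : AbelianVariety ℂ) (g : A.X ⟶ B'.X) (d : ℕ) (ψ : B' ⟶ B') (w : complexBetti B'.X (2 * 3)),
            B'.dim = 6 ∧ 0 < d ∧ ψ ≫ ψ = -(d • 𝟙 B') ∧ IsRationalClass w ∧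
            IsOfHodgeType B'.dim B'.X (2 * 3) 3 3 w ∧ w ∈ weilClassesOf B' ψ 3 d ∧
            w' = complexBetti.map g (2 * 3) w}) :=
  census_of_isIsogenous_prod_of_productSpan h0Y h0S
    (hodgeClassesProductSpan_of_lowGeneric_of_forall_hom_eq_zero h0S hS3 hSend hYS) hA

/-! ## §5 A SIMPLE factor times a CM elliptic curve whose field misses the centre (Moonen–Zarhin Prop. (3.8)) -/

/-- **`Y × E`, `Y` SIMPLE of positive dimension, `E` an elliptic curve with `χ ≫ χ = −d′` (`d′ > 0`), and no central
`z ∈ End⁰(Y)` with `z² = −d′`** («`ℚ(√−d′)` does not embed in the centre of `End⁰(Y)`»): both census conclusions at every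
`A ∼ Y × E` (`hodgeClassesProductSpan_of_isSimple_cmCurve`, MZ99 Prop. (3.8) with (3.1)). UNCONDITIONAL; any `dim Y`; all
Albert types of `Y`, any signature. [cite: MoonenZarhin1999LowDim, §3 (3.1), Lemma (3.6) and Prop. (3.8)] -/
theorem census_of_isIsogenous_isSimple_prod_cmCurve {A Y E : AbelianVariety ℂ} (hYs : Y.IsSimple) (h0Y : 0 < Y.dim)
    (hE1 : E.dim = 1) (χ : E ⟶ E) {d' : ℕ} (hd' : 0 < d') (hχ : χ ≫ χ = -(d' • 𝟙 E))
    (hno : ∀ z ∈ Subalgebra.center ℚ Y.endAlgebra, z * z ≠ -((d' : ℚ) • 1)) (hA : IsIsogenous A (Y.prod E)) :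
    (∀ c : complexBetti A.X (2 * 2), IsRationalClass c → IsOfHodgeType A.dim A.X (2 * 2) 2 2 c →
      c ∈ divisorClassesSpan A.X A.dim 2 ⊔ Submodule.span ℂ {w' : complexBetti A.X (2 * 2) |
        ∃ (C : AbelianVariety ℂ) (g : A.X ⟶ C.X) (w : complexBetti C.X (2 * 2)), C.dim < A.dim ∧
          IsRationalClass w ∧ IsOfHodgeType C.dim C.X (2 * 2) 2 2 w ∧ w' = complexBetti.map g (2 * 2) w}) ∧
    (∀ c : complexBetti A.X (2 * 3), IsRationalClass c → IsOfHodgeType A.dim A.X (2 * 3) 3 3 c →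
      c ∈ divisorClassesSpan A.X A.dim 3 ⊔ Submodule.span ℂ {w' : complexBetti A.X (2 * 3) |
          ∃ (a : complexBetti A.X (2 * 2)) (b : complexBetti A.X (2 * 1)),
            IsRationalClass a ∧ IsOfHodgeType A.dim A.X (2 * 2) 2 2 a ∧ IsRationalClass b ∧
            IsOfHodgeType A.dim A.X (2 * 1) 1 1 b ∧ w' = cupProduct (two_mul_add_two_mul 2 1) a b} ⊔
        Submodule.span ℂ {w' : complexBetti A.X (2 * 3) |
          ∃ (C : AbelianVariety ℂ) (g : A.X ⟶ C.X) (w : complexBetti C.X (2 * 3)), C.dim < A.dim ∧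
            IsRationalClass w ∧ IsOfHodgeType C.dim C.X (2 * 3) 3 3 w ∧ w' = complexBetti.map g (2 * 3) w} ⊔
        Submodule.span ℂ {w' : complexBetti A.X (2 * 3) |
          ∃ (B' : AbelianVariety ℂ) (g : A.X ⟶ B'.X) (d : ℕ) (ψ : B' ⟶ B') (w : complexBetti B'.X (2 * 3)),
            B'.dim = 6 ∧ 0 < d ∧ ψ ≫ ψ = -(d • 𝟙 B') ∧ IsRationalClass w ∧
            IsOfHodgeType B'.dim B'.X (2 * 3) 3 3 w ∧ w ∈ weilClassesOf B' ψ 3 d ∧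
            w' = complexBetti.map g (2 * 3) w}) :=
  census_of_isIsogenous_prod_of_productSpan h0Y (by omega)
    (hodgeClassesProductSpan_of_isSimple_cmCurve hYs h0Y hE1 χ hd' hχ hno) hA

/-- **AT DIMENSION 6, WITH DOMAIN MEMBERSHIP: a SIMPLE NON-CM FIVEFOLD times a CM elliptic curve whose field misses the
centre.** Every `A ∼ Y × E` with `Y` simple, `dim Y = 5`, `Y` not of CM type, `E` a curve with `χ ≫ χ = −d′` (`d′ > 0`) and no
central square root of `−d′` in `End⁰(Y)` satisfies `dim A = 6 ∧ ¬ 𝒞 A` (L9b / L9c: CM type would pass to `Y`; the K3P cell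
needs a fourfold factor) AND X2-at-`A` ∧ X1-at-`A`. UNCONDITIONAL. Members: `Y` of type I(1) (`Hg = Sp₁₀`), type IV with
`End⁰(Y) = k′ ≠ ℚ(√−d′)` of any signature, … — every simple non-CM fivefold except the resonant type-IV ones.
[cite: MoonenZarhin1999LowDim, Prop. (3.8), §3 (3.1) and §5 (5.1)] [cite: Milne1999, §2 p. 54] -/
theorem sixfoldCensus_of_isIsogenous_simpleFivefold_prod_cmCurve {A Y E : AbelianVariety ℂ} (hYs : Y.IsSimple)
    (hY5 : Y.dim = 5) (hYcm : ¬ IsOfCMType Y) (hE1 : E.dim = 1) (χ : E ⟶ E) {d' : ℕ} (hd' : 0 < d')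
    (hχ : χ ≫ χ = -(d' • 𝟙 E)) (hno : ∀ z ∈ Subalgebra.center ℚ Y.endAlgebra, z * z ≠ -((d' : ℚ) • 1))
    (hA : IsIsogenous A (Y.prod E)) :
    (A.dim = 6 ∧ ¬ (IsOfCMType A ∨ ProdCMCell IsQuarticFieldTypeIVFourfold (fun Z ↦ Z.dim = 2) A)) ∧
    (∀ c : complexBetti A.X (2 * 2), IsRationalClass c → IsOfHodgeType A.dim A.X (2 * 2) 2 2 c →
      c ∈ divisorClassesSpan A.X A.dim 2 ⊔ Submodule.span ℂ {w' : complexBetti A.X (2 * 2) |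
        ∃ (C : AbelianVariety ℂ) (g : A.X ⟶ C.X) (w : complexBetti C.X (2 * 2)), C.dim < A.dim ∧
          IsRationalClass w ∧ IsOfHodgeType C.dim C.X (2 * 2) 2 2 w ∧ w' = complexBetti.map g (2 * 2) w}) ∧
    (∀ c : complexBetti A.X (2 * 3), IsRationalClass c → IsOfHodgeType A.dim A.X (2 * 3) 3 3 c →
      c ∈ divisorClassesSpan A.X A.dim 3 ⊔ Submodule.span ℂ {w' : complexBetti A.X (2 * 3) |
          ∃ (a : complexBetti A.X (2 * 2)) (b : complexBetti A.X (2 * 1)),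
            IsRationalClass a ∧ IsOfHodgeType A.dim A.X (2 * 2) 2 2 a ∧ IsRationalClass b ∧
            IsOfHodgeType A.dim A.X (2 * 1) 1 1 b ∧ w' = cupProduct (two_mul_add_two_mul 2 1) a b} ⊔
        Submodule.span ℂ {w' : complexBetti A.X (2 * 3) |
          ∃ (C : AbelianVariety ℂ) (g : A.X ⟶ C.X) (w : complexBetti C.X (2 * 3)), C.dim < A.dim ∧
            IsRationalClass w ∧ IsOfHodgeType C.dim C.X (2 * 3) 3 3 w ∧ w' = complexBetti.map g (2 * 3) w} ⊔
        Submodule.span ℂ {w' : complexBetti A.X (2 * 3) |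
          ∃ (B' : AbelianVariety ℂ) (g : A.X ⟶ B'.X) (d : ℕ) (ψ : B' ⟶ B') (w : complexBetti B'.X (2 * 3)),
            B'.dim = 6 ∧ 0 < d ∧ ψ ≫ ψ = -(d • 𝟙 B') ∧ IsRationalClass w ∧
            IsOfHodgeType B'.dim B'.X (2 * 3) 3 3 w ∧ w ∈ weilClassesOf B' ψ 3 d ∧
            w' = complexBetti.map g (2 * 3) w}) :=
  ⟨⟨dim_eq_six_of_isIsogenous_prod hA (by omega),
      not_residueClass_of_isIsogenous_prod_of_isSimple_of_not_isOfCMType hYs hYcm (by omega) (Or.inl (by omega))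
        (AbelianVariety.isSimple_of_dim_le_one hE1.le) (by omega) (by omega) hA⟩,
    census_of_isIsogenous_isSimple_prod_cmCurve hYs (by omega) hE1 χ hd' hχ hno hA⟩

/-! ## §6 A factor with semisimple Hodge group (`Θ`-trace condition) times a CM factor -/

/-- **`Y × C`, `Y` with the `Θ`-trace condition (`HodgeThetaTraceCondition Y`: «`Hg(Y)` semisimple» in Lie form — e.g. no
type-IV factor, `hodgeThetaTraceCondition_of_hasNoTypeIVFactor`, or BALANCED Weil type, `hodgeThetaTraceCondition_of_balanced`)
and `C` of CM type**: both census conclusions at every `A ∼ Y × C` (`hodgeClassesProductSpan_of_thetaTrace_of_isOfCMType`).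
UNCONDITIONAL; any dimensions; e.g. a Weil-type `(2,2)` fourfold times a CM surface, whose Weil classes reach the sixfold as
pull-backs from dimension 4. [cite: MoonenZarhin1998WeilClasses, §1 Remark (1) after Criterion (2)]
[cite: MoonenZarhin1999LowDim, §3 (3.1)] [cite: Deligne1982HodgeCycles, I §3 Prop. 3.6] -/
theorem census_of_isIsogenous_prod_thetaTrace_cm {A Y C : AbelianVariety ℂ} (h0Y : 0 < Y.dim) (h0C : 0 < C.dim)
    (hY : HodgeThetaTraceCondition Y) (hC : IsOfCMType C) (hA : IsIsogenous A (Y.prod C)) :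
    (∀ c : complexBetti A.X (2 * 2), IsRationalClass c → IsOfHodgeType A.dim A.X (2 * 2) 2 2 c →
      c ∈ divisorClassesSpan A.X A.dim 2 ⊔ Submodule.span ℂ {w' : complexBetti A.X (2 * 2) |
        ∃ (C : AbelianVariety ℂ) (g : A.X ⟶ C.X) (w : complexBetti C.X (2 * 2)), C.dim < A.dim ∧
          IsRationalClass w ∧ IsOfHodgeType C.dim C.X (2 * 2) 2 2 w ∧ w' = complexBetti.map g (2 * 2) w}) ∧
    (∀ c : complexBetti A.X (2 * 3), IsRationalClass c → IsOfHodgeType A.dim A.X (2 * 3) 3 3 c →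
      c ∈ divisorClassesSpan A.X A.dim 3 ⊔ Submodule.span ℂ {w' : complexBetti A.X (2 * 3) |
          ∃ (a : complexBetti A.X (2 * 2)) (b : complexBetti A.X (2 * 1)),
            IsRationalClass a ∧ IsOfHodgeType A.dim A.X (2 * 2) 2 2 a ∧ IsRationalClass b ∧
            IsOfHodgeType A.dim A.X (2 * 1) 1 1 b ∧ w' = cupProduct (two_mul_add_two_mul 2 1) a b} ⊔
        Submodule.span ℂ {w' : complexBetti A.X (2 * 3) |
          ∃ (C : AbelianVariety ℂ) (g : A.X ⟶ C.X) (w : complexBetti C.X (2 * 3)), C.dim < A.dim ∧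
            IsRationalClass w ∧ IsOfHodgeType C.dim C.X (2 * 3) 3 3 w ∧ w' = complexBetti.map g (2 * 3) w} ⊔
        Submodule.span ℂ {w' : complexBetti A.X (2 * 3) |
          ∃ (B' : AbelianVariety ℂ) (g : A.X ⟶ B'.X) (d : ℕ) (ψ : B' ⟶ B') (w : complexBetti B'.X (2 * 3)),
            B'.dim = 6 ∧ 0 < d ∧ ψ ≫ ψ = -(d • 𝟙 B') ∧ IsRationalClass w ∧
            IsOfHodgeType B'.dim B'.X (2 * 3) 3 3 w ∧ w ∈ weilClassesOf B' ψ 3 d ∧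
            w' = complexBetti.map g (2 * 3) w}) :=
  census_of_isIsogenous_prod_of_productSpan h0Y h0C (hodgeClassesProductSpan_of_thetaTrace_of_isOfCMType hY hC) hA

end Summit.HodgeConjecture.HodgeConjecture.TableX.ProductRows
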